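import Literature.Algebra.Lie.LefschetzModuleStringReversal
import Literature.Algebra.Lie.LefschetzSl2Type
import Literature.Algebra.Lie.Sl2Intertwiner
import HarnessLib

/-!
# Lefschetz `𝔞`-submodules are `𝔤(𝔞, M)`-submodules (Looijenga–Lunts 1997, §1 (1.2): "irreducible as a Lefschetz module iff irreducible as a `𝔤(𝔞, M)`-module")

Topic `Literature/Algebra/Lie` (namespace `Literature.Algebra.Lie`).  Lane `lit-hodgefound` (Track 2 foundations
library), skeleton seat `lit-hodgefound-skel-1` (generation 44), row **A1-138** of
`run/shared/lean/pub/lit-hodgefound/SKELETON.md`; a theorems-only rider on A1-88 `LefschetzModule.lean` and the tree's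
`Sl2Intertwiner.lean` (naturality of the `𝔰𝔩₂`-partner), for the sentence of Looijenga–Lunts (1.2) "A Lefschetz
`𝔞`-module `M` is irreducible as a Lefschetz module iff it is irreducible as a `𝔤(𝔞, M)`-module" — the direction
"Lefschetz `𝔞`-submodule ⟹ `𝔤(𝔞, M)`-submodule": an `h`-stable, `𝔞`-stable subspace `W ⊆ M` that is a Lefschetz module
in its own right (for the restricted grading and SOME `a₀ ∈ 𝔞`) is stable under the whole of `𝔤(𝔞, M)`, i.e. under every
partner `f_a`, `a ∈ dom f`.  (The other direction — a `𝔤(𝔞, M)`-submodule `W ⊄ M₀` is a Lefschetz module with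
`𝔤(𝔞|_W, W) = 𝔤(𝔞, M)|_W` — is `IsLefschetzModule.isLefschetzModule_subRep` in
`LefschetzTripleIdealsTensorFactors.lean`, A1-137.)  Finite dimension over a field of characteristic `0`.  THEOREMS
ONLY; no definition, no named fact, no `sorry`, no instance, no notation (D-0026 net debt `0`); `LieRing.ofAssociativeRing`
FILE-LOCAL as in every parent.

## Source, VERBATIM

E. Looijenga, V. A. Lunts, *A Lie algebra attached to a projective variety*, Invent. Math. **129** (1997) 361–412,
§1 (1.2) (held TeX text `paper:arxiv-alg-geom_9604014`, p0004 L62–L70 and L90–L91):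

> "The collection of Lefschetz modules is closed under direct sums, tensor products and taking duals. … Since any
> representation of a semisimple Lie algebra is reductive, the category of Lefschetz modules of `𝔞` is semisimple.
> A Lefschetz `𝔞`-module `M` is irreducible as a Lefschetz module if and only if it is irreducible as a `𝔤(𝔞, M)`-module. …
> The preceding discussion showed that when studying Lefschetz modules we may restrict ourselves to irreducible ones."

and (1.1) p0004 L1–L5 ("`e^k` maps `M_{-k}` isomorphically onto `M_k` … This `f` is then unique").

## Rendering (dictionary)

* "Lefschetz `𝔞`-submodule `W ⊆ M`" = a subspace `W : Submodule K M` stable under `h` (`hWh`) and under `𝔞` (`hW𝔞`),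
  graded by `h|_W` (automatically `ℤ`-graded, `isZGrading_restrict`), on which some `a₀ ∈ 𝔞` has the Lefschetz property
  (`L₀ : HasLefschetzProperty (h.restrict hWh) (a₀.restrict _)`); "`𝔤(𝔞, M)`-submodule" = `∀ x ∈ 𝔤(𝔞, M), x W ⊆ W`.

## Contents (all proved)

* §1 `mem_degreeSpace_restrict_iff`, **`isZGrading_restrict`** (an `h`-stable
  subspace of a `ℤ`-graded space is `ℤ`-graded — the hypothesis `hgrW` of `Sl2Intertwiner.apply_eq_of_isSl2Triple_restrict`
  is automatic).
* §2 **`HasLefschetzProperty.comp_dual_eq_dual_comp`** — the `HasLefschetzProperty.dual` form (no `h ≠ 0` hypotheses)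
  of the tree's `comp_dual_eq_dual_comp_of_isSl2Triple`: a map intertwining `(h', e')` with `(h, e)` intertwines the
  partners.
* §3 `HasLefschetzProperty.subtype_comp_dual_restrict`, **`HasLefschetzProperty.dual_apply_mem_of_restrict`** (a
  subspace stable under `h`, `e` on which `e` is again Lefschetz is `f`-stable, `f|_W` = the partner of `e|_W`).
* §4 **`HasLefschetzProperty.restrict_of_finrank_eq`** (if `dim W_{-k} = dim W_k` for all `k` — e.g. `W` is Lefschetz
  for some operator, `finrank_degreeSpace_eq_neg` — then EVERY Lefschetz `a` of `M` preserving `W` is Lefschetz on `W`: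
  `aᵏ|W_{-k}` is injective between equidimensional spaces).
* §5 **`lefschetzLieAlgebra_le_stabilizer`**, **`IsLefschetzModule.stable_of_lefschetzSubmodule`** — a Lefschetz
  `𝔞`-submodule is a `𝔤(𝔞, M)`-submodule.

## SCOPE

(a) "Irreducible as a Lefschetz module" is not introduced as a notion; the file proves that Lefschetz `𝔞`-submodules
(as rendered above) are `𝔤(𝔞, M)`-submodules, from which the printed equivalence follows together with A1-137 §4.
(b) Nothing here concerns complex tori or the Hodge conjecture.

## References

* [LooijengaLunts1997] E. Looijenga, V. A. Lunts, *A Lie algebra attached to a projective variety*, Invent. Math.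
  129 (1997) 361–412; arXiv:alg-geom/9604014. §1 (1.2), p. 4 L62–L70, L90–L91 of the held TeX text; (1.1) p. 4 L1–L5.
* [Andre1996Motifs] Y. André, *Pour une théorie inconditionnelle des motifs*, Publ. Math. IHÉS 83 (1996), §1.1 —
  via `LefschetzModule.lean` / `Sl2Intertwiner.lean` (André's formula for `ᶜΛ`).
-/

namespace Literature.Algebra.Lie

open Module Function Set
open HasLefschetzProperty (primitiveSpace mem_primitiveSpace_iff)

-- The commutator Lie ring of `𝔤𝔩(M) = Module.End K M`: Mathlib's reducible NON-instance, enabled file-locally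
-- exactly as in `LefschetzModule.lean`.
attribute [local instance 100] LieRing.ofAssociativeRing

variable {K : Type*} [Field K] {M : Type*} [AddCommGroup M] [Module K M]

/-! ### §1 The grading restricted to an `h`-stable subspace -/

section Restrict

variable {h : Module.End K M} {W : Submodule K M}

/-- Degrees of the restricted grading: `w ∈ W_k ↔ w ∈ M_k`. [cite: LooijengaLunts1997, §1 (1.1) p0003 L106–L111 (graded vector spaces)] -/
theorem mem_degreeSpace_restrict_iff (hW : ∀ w ∈ W, h w ∈ W) {k : ℤ} {w : W} :
    w ∈ degreeSpace (h.restrict hW) k ↔ (w : M) ∈ degreeSpace h k := by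
  rw [mem_degreeSpace_iff, mem_degreeSpace_iff, ← Subtype.coe_inj, LinearMap.coe_restrict_apply, Submodule.coe_smul]

/-- **An `h`-stable subspace of a `ℤ`-graded space is `ℤ`-graded** by the restriction of `h`: `W = ⊕ₖ (W ∩ M_k)`
(an `h`-stable subspace of a diagonalisable operator is the sum of its intersections with the eigenspaces).
[cite: LooijengaLunts1997, §1 (1.2) p0004 L101–L105 ("the grading … is the eigen space decomposition of ad_h … making the decomposition a graded one")] -/
theorem isZGrading_restrict [FiniteDimensional K M] (hgr : IsZGrading h) (hW : ∀ w ∈ W, h w ∈ W) :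
    IsZGrading (h.restrict hW) := by
  rw [IsZGrading, eq_top_iff]
  rintro ⟨w, hw⟩ -
  -- `W = ⨆_μ W ∩ E_μ`
  have htop : ⨆ μ : K, h.genEigenspace μ 1 = ⊤ := by
    rw [eq_top_iff, ← hgr]
    exact iSup_le fun k ↦ le_iSup (fun μ : K ↦ h.genEigenspace μ 1) (k : K)
  have hWeq := Submodule.eq_iSup_inf_genEigenspace 1 hW htop
  have hw' : w ∈ ⨆ μ : K, W ⊓ h.genEigenspace μ 1 := hWeq ▸ hw
  -- push the decomposition into `W`
  suffices H : ∀ x ∈ ⨆ μ : K, W ⊓ h.genEigenspace μ 1,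
      ∃ hx : x ∈ W, (⟨x, hx⟩ : W) ∈ ⨆ k : ℤ, degreeSpace (h.restrict hW) k by
    obtain ⟨_, h1⟩ := H w hw'
    exact h1
  intro x hx
  induction hx using Submodule.iSup_induction' with
  | mem μ x hx =>
    refine ⟨hx.1, ?_⟩
    by_cases hμ : ∃ k : ℤ, (k : K) = μ
    · obtain ⟨k, rfl⟩ := hμ
      refine Submodule.mem_iSup_of_mem k ((mem_degreeSpace_restrict_iff hW).2 ?_)
      exact hx.2
    · push Not at hμ
      have h1 : x ∈ Module.End.eigenspace h μ := hx.2
      rw [eigenspace_eq_bot_of_forall_ne hgr hμ, Submodule.mem_bot] at h1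
      subst h1
      exact (⨆ k : ℤ, degreeSpace (h.restrict hW) k).zero_mem
  | zero => exact ⟨W.zero_mem, (⨆ k : ℤ, degreeSpace (h.restrict hW) k).zero_mem⟩
  | add x y _ _ hx hy =>
    obtain ⟨hx1, hx2⟩ := hx
    obtain ⟨hy1, hy2⟩ := hy
    exact ⟨W.add_mem hx1 hy1, Submodule.add_mem _ hx2 hy2⟩

end Restrict

/-! ### §2 A map intertwining `e` and `h` intertwines the partners `f` -/

section Intertwine

variable [CharZero K] [FiniteDimensional K M] {M' : Type*} [AddCommGroup M'] [Module K M'] [FiniteDimensional K M']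
  {h e : Module.End K M} {h' e' : Module.End K M'}

/-- **A linear map intertwining `(h', e')` with `(h, e)` intertwines the constructed partners: `φ ∘ f' = f ∘ φ`** —
the `HasLefschetzProperty.dual` form of the tree's `comp_dual_eq_dual_comp_of_isSl2Triple` (`Sl2Intertwiner.lean`,
stated for `𝔰𝔩₂`-triples, i.e. with `h, h' ≠ 0`); here without non-vanishing hypotheses, by extensionality on strings
(`linearMap_ext_of_strings`): on `e'ʲ p` both sides are `j(k - j + 1) · eʲ⁻¹ φ(p)` by André's formula, `φ(p)` being
primitive (`apply_mem_primitiveSpace_of_comp_eq`). [cite: LooijengaLunts1997, §1 (1.1) p0004 L1–L5 ("This f is then unique")] [cite: Andre1996Motifs, §1.1 (formula for ᶜΛ)] -/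
theorem HasLefschetzProperty.comp_dual_eq_dual_comp (L : HasLefschetzProperty h e) (hgr : IsZGrading h)
    (L' : HasLefschetzProperty h' e') (hgr' : IsZGrading h') (φ : M' →ₗ[K] M) (hφh : φ ∘ₗ h' = h ∘ₗ φ)
    (hφe : φ ∘ₗ e' = e ∘ₗ φ) : φ ∘ₗ L'.dual hgr' = L.dual hgr ∘ₗ φ := by
  refine L'.linearMap_ext_of_strings hgr' fun k p hp j hj ↦ ?_
  have hφp := apply_mem_primitiveSpace_of_comp_eq φ hφh hφe hp
  rw [LinearMap.comp_apply, LinearMap.comp_apply, apply_pow_apply_of_comp_eq φ hφe]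
  cases j with
  | zero =>
    rw [pow_zero, pow_zero, Module.End.one_apply, Module.End.one_apply, L'.dual_apply_primitive hgr' hp,
      L.dual_apply_primitive hgr hφp, map_zero]
  | succ j =>
    rw [L'.dual_apply_pow_primitive hgr' hp j, L.dual_apply_pow_primitive hgr hφp j, map_smul,
      apply_pow_apply_of_comp_eq φ hφe]

end Intertwine

/-! ### §3 A Lefschetz submodule is stable under the partners `f` -/

section Submodule

variable [CharZero K] [FiniteDimensional K M] {h e : Module.End K M} {W : Submodule K M}

/-- **A subspace `W` stable under `h` and `e` on which `e` again has the Lefschetz property (for the restricted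
grading) is stable under the partner `f` of `e`**, and `f|_W` is the partner of `e|_W` (apply
`comp_dual_eq_dual_comp` to the inclusion `W ⊆ M`). [cite: LooijengaLunts1997, §1 (1.2) p0004 L69–L70 ("A Lefschetz 𝔞-module M is irreducible as a Lefschetz module if and only if it is irreducible as a 𝔤(𝔞, M)-module")] -/
theorem HasLefschetzProperty.subtype_comp_dual_restrict (L : HasLefschetzProperty h e) (hgr : IsZGrading h)
    (hWh : ∀ w ∈ W, h w ∈ W) (hWe : ∀ w ∈ W, e w ∈ W)
    (LW : HasLefschetzProperty (h.restrict hWh) (e.restrict hWe)) :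
    W.subtype ∘ₗ LW.dual (isZGrading_restrict hgr hWh) = L.dual hgr ∘ₗ W.subtype :=
  L.comp_dual_eq_dual_comp hgr LW (isZGrading_restrict hgr hWh) W.subtype (LinearMap.ext fun _ ↦ rfl)
    (LinearMap.ext fun _ ↦ rfl)

/-- Hence `f W ⊆ W`. [cite: LooijengaLunts1997, §1 (1.2) p0004 L69–L70] -/
theorem HasLefschetzProperty.dual_apply_mem_of_restrict (L : HasLefschetzProperty h e) (hgr : IsZGrading h)
    (hWh : ∀ w ∈ W, h w ∈ W) (hWe : ∀ w ∈ W, e w ∈ W)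
    (LW : HasLefschetzProperty (h.restrict hWh) (e.restrict hWe)) {w : M} (hw : w ∈ W) : L.dual hgr w ∈ W := by
  have h1 := LinearMap.congr_fun (L.subtype_comp_dual_restrict hgr hWh hWe LW) ⟨w, hw⟩
  simp only [LinearMap.comp_apply, Submodule.subtype_apply] at h1
  rw [← h1]
  exact Submodule.coe_mem _

/-! ### §4 The Lefschetz locus of a Lefschetz submodule contains that of `M` -/

omit [CharZero K] in
/-- **If `W` is `h`-stable, `a`-stable and has symmetric degree dimensions `dim W_{-k} = dim W_k` (e.g. `W` is a
Lefschetz module for SOME operator, `finrank_degreeSpace_eq_neg`), then every Lefschetz operator `a` of `M` restricts to a Lefschetz operator of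
`W`**: `aᵏ : W_{-k} → W_k` is injective (it is on `M_{-k}`) between spaces of the same dimension.
[cite: LooijengaLunts1997, §1 (1.1) p0004 L1–L2 ("e^k maps M_{-k} isomorphically onto M_k")] -/
theorem HasLefschetzProperty.restrict_of_finrank_eq {a : Module.End K M} (La : HasLefschetzProperty h a)
    (hWh : ∀ w ∈ W, h w ∈ W) (hWa : ∀ w ∈ W, a w ∈ W)
    (hdim : ∀ k : ℕ, finrank K (degreeSpace (h.restrict hWh) (-(k : ℤ))) = finrank K (degreeSpace (h.restrict hWh) k)) :
    HasLefschetzProperty (h.restrict hWh) (a.restrict hWa) := by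
  have hpow : ∀ (k : ℕ) (w : W), (((a.restrict hWa) ^ k) w : M) = (a ^ k) (w : M) := by
    intro k w
    induction k generalizing w with
    | zero => simp
    | succ k ih => rw [pow_succ, pow_succ, Module.End.mul_apply, Module.End.mul_apply, ih]; rfl
  refine ⟨fun k w hw ↦ ?_, fun k ↦ ?_⟩
  · rw [SetLike.mem_coe, mem_degreeSpace_restrict_iff] at hw ⊢
    exact La.mapsTo k hw
  · -- injective on `W_{-k}` and the dimensions agree, so bijective onto `W_k`
    have hmaps : MapsTo (⇑((a.restrict hWa) ^ k)) (degreeSpace (h.restrict hWh) (-(k : ℤ)))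
        (degreeSpace (h.restrict hWh) k) := by
      intro w hw
      rw [SetLike.mem_coe, mem_degreeSpace_restrict_iff] at hw ⊢
      rw [hpow]
      exact (La.bijOn k).mapsTo hw
    have hinj : InjOn (⇑((a.restrict hWa) ^ k)) (degreeSpace (h.restrict hWh) (-(k : ℤ))) := by
      intro w hw w' hw' hww'
      rw [SetLike.mem_coe, mem_degreeSpace_restrict_iff] at hw hw'
      have h1 : (a ^ k) (w : M) = (a ^ k) (w' : M) := by
        rw [← hpow, ← hpow]; exact congrArg Subtype.val hww'
      exact Subtype.ext ((La.bijOn k).injOn hw hw' h1)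
    refine ⟨hmaps, hinj, ?_⟩
    -- surjectivity by dimension count on the restricted linear map
    set g : degreeSpace (h.restrict hWh) (-(k : ℤ)) →ₗ[K] degreeSpace (h.restrict hWh) k :=
      ((a.restrict hWa) ^ k).restrict (p := degreeSpace (h.restrict hWh) (-(k : ℤ)))
        (q := degreeSpace (h.restrict hWh) k) fun w hw ↦ hmaps hw with hg
    have hginj : Function.Injective g := by
      intro w w' hww'
      exact Subtype.ext (hinj w.2 w'.2 (by simpa [hg] using congrArg Subtype.val hww'))
    have hgsurj : Function.Surjective g :=
      (LinearMap.injective_iff_surjective_of_finrank_eq_finrank (hdim k)).1 hginj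
    intro v hv
    obtain ⟨w, hw⟩ := hgsurj ⟨v, hv⟩
    exact ⟨w, w.2, by simpa [hg] using congrArg Subtype.val hw⟩

/-! ### §5 Lefschetz `𝔞`-submodules are `𝔤(𝔞, M)`-submodules -/

variable {𝔞 : Submodule K (Module.End K M)}

/-- **A Lefschetz `𝔞`-submodule is a `𝔤(𝔞, M)`-submodule**: let `(𝔞, M)` be graded by `h` (`IsZGrading`), `W` an
`h`-stable, `𝔞`-stable subspace which is a Lefschetz module for some `a₀ ∈ 𝔞` (its own Lefschetz locus is non-empty);
then `W` is stable under all of `𝔤(𝔞, M)` — every `f_a`, `a ∈ dom f`, preserves `W` (`a|_W` is Lefschetz by §4,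
so `f_a|_W` is its partner by §3).  This is one half of "a Lefschetz `𝔞`-module `M` is irreducible as a Lefschetz
module iff it is irreducible as a `𝔤(𝔞, M)`-module"; the other half (a `𝔤(𝔞, M)`-submodule `W ⊄ M₀` is a Lefschetz
module) is `IsLefschetzModule.isLefschetzModule_subRep` in `LefschetzTripleIdealsTensorFactors.lean`.
[cite: LooijengaLunts1997, §1 (1.2) p0004 L69–L70 ("A Lefschetz 𝔞-module M is irreducible as a Lefschetz module if and only if it is irreducible as a 𝔤(𝔞, M)-module")] -/
theorem lefschetzLieAlgebra_le_stabilizer (hgr : IsZGrading h) (hWh : ∀ w ∈ W, h w ∈ W)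
    (hW𝔞 : ∀ a ∈ 𝔞, ∀ w ∈ W, a w ∈ W) {a₀ : Module.End K M} (ha₀ : a₀ ∈ 𝔞)
    (L₀ : HasLefschetzProperty (h.restrict hWh) (a₀.restrict (hW𝔞 a₀ ha₀))) :
    ∀ x ∈ lefschetzLieAlgebra K h 𝔞, ∀ w ∈ W, x w ∈ W := by
  -- the stabiliser of `W` as a Lie subalgebra of `𝔤𝔩(M)`
  let H : LieSubalgebra K (Module.End K M) :=
    { carrier := {x | ∀ w ∈ W, x w ∈ W}
      add_mem' := fun {x y} hx hy w hw ↦ by rw [LinearMap.add_apply]; exact W.add_mem (hx w hw) (hy w hw)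
      zero_mem' := fun w _ ↦ by rw [LinearMap.zero_apply]; exact W.zero_mem
      smul_mem' := fun c {x} hx w hw ↦ by rw [LinearMap.smul_apply]; exact W.smul_mem c (hx w hw)
      lie_mem' := fun {x y} hx hy w hw ↦ by
        rw [Ring.lie_def, LinearMap.sub_apply, Module.End.mul_apply, Module.End.mul_apply]
        exact W.sub_mem (hx _ (hy w hw)) (hy _ (hx w hw)) }
  have hle : lefschetzLieAlgebra K h 𝔞 ≤ H := by
    rw [lefschetzLieAlgebra_le_iff]
    refine ⟨fun a ha ↦ hW𝔞 a ha, ?_⟩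
    rintro f ⟨a, ha, t⟩
    have La : HasLefschetzProperty h a := hasLefschetzProperty_of_isSl2Triple hgr t
    have hdim : ∀ k : ℕ, finrank K (degreeSpace (h.restrict hWh) (-(k : ℤ))) =
        finrank K (degreeSpace (h.restrict hWh) k) := fun k ↦ (finrank_degreeSpace_eq_neg L₀ k).symm
    have LaW := La.restrict_of_finrank_eq hWh (hW𝔞 a ha) hdim
    rw [La.eq_dual_of_isSl2Triple hgr t]
    exact fun w hw ↦ La.dual_apply_mem_of_restrict hgr hWh (hW𝔞 a ha) LaW hw
  intro x hx
  exact hle hx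

/-- In particular for a Lefschetz module `(𝔞, M)` (A1-88): a Lefschetz `𝔞`-submodule `W` is a `𝔤(𝔞, M)`-submodule.
[cite: LooijengaLunts1997, §1 (1.2) p0004 L69–L70] -/
theorem IsLefschetzModule.stable_of_lefschetzSubmodule (A : IsLefschetzModule K h 𝔞) (hWh : ∀ w ∈ W, h w ∈ W)
    (hW𝔞 : ∀ a ∈ 𝔞, ∀ w ∈ W, a w ∈ W) {a₀ : Module.End K M} (ha₀ : a₀ ∈ 𝔞)
    (L₀ : HasLefschetzProperty (h.restrict hWh) (a₀.restrict (hW𝔞 a₀ ha₀))) :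
    ∀ x ∈ lefschetzLieAlgebra K h 𝔞, ∀ w ∈ W, x w ∈ W :=
  lefschetzLieAlgebra_le_stabilizer A.isZGrading hWh hW𝔞 ha₀ L₀

end Submodule

end Literature.Algebra.Lie
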